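import Literature.AlgebraicGeometry.Motives.SubHodgeStructureHodgeGroupStable
import Literature.AlgebraicGeometry.Motives.HodgeGroupInvariantsRationalPoints
import Literature.AlgebraicGeometry.Motives.HodgeStructureRankOne
import Literature.AlgebraicGeometry.Motives.HodgeTensorFactsHolds
import HarnessLib

/-!
# A subspace underlies a sub-Hodge structure iff its top exterior power is a Hodge class iff its determinant line is a
# sub-Hodge structure of `⋀ᵈ H` (Cattani–Deligne–Kaplan, proof of Cor. 1.4)

Topic `Literature/AlgebraicGeometry/Motives` (namespace `Literature.AlgebraicGeometry.Motives.HodgeStructure`), lane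
`lit-hodgefound` (seat `p08`, row g55-#1).  THEOREMS ONLY: no definition, no named fact, no instance (net debt `0`).

PRINTED SOURCE, VERBATIM (E. Cattani, P. Deligne, A. Kaplan, *On the locus of Hodge classes*, J. Amer. Math. Soc. 8 (1995)
483–506, proof of Corollary 1.4, p. 486; held text `paper:arxiv-alg-geom_9402009` p0001–p0002).  «**Corollary 1.4.** Let `𝒱` be a
polarizable variation of Hodge structures on `S`, fix `s ∈ S` and let `U_ℚ ⊂ (𝒱_s)_ℚ` be a rational subspace. The locus where some
flat translate of `U_ℚ` is a Hodge substructure is an algebraic subvariety of `S`.  *Proof*: … suppose first that `U_ℚ` is of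
dimension one. … Let `e` be a generator of `U_ℚ ∩ 𝒱_ℤ`. Then `U_ℚ` is a Hodge substructure if and only if `e` is of type `(0,0)`,
and one applies 1.3.  Consider now the general case: `U` of dimension `n`. A Hodge structure on a rational vector space `H_ℚ`
gives rise to an action of the real algebraic group `ℂ*` on `H_ℝ = H_ℚ ⊗ ℝ`, with `z ∈ ℂ*` acting as multiplication by
`z^{-p} z̄^{-q}` on `H^{p,q}`. A subspace `U_ℚ ⊂ H_ℚ` is a sub-Hodge structure — i.e., `U_ℂ = U_ℚ ⊗ ℂ` is the sum of its
intersections with the `H^{p,q}` — if and only if `U_ℝ` is stable under `ℂ*`. This amounts to `⋀ⁿ U_ℝ ⊂ ⋀ⁿ H_ℝ` being stable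
under `ℂ*`, i.e., to `⋀ⁿ U_ℚ` being a Hodge substructure of `⋀ⁿ H_ℚ`, and reduces us to the one-dimensional case, proving 1.4.»

THIS FILE is that linear algebra, for a pure `ℚ`-Hodge structure `H : HodgeStructure V n` on a finite-dimensional `V`
(`Motives/HodgeStructure`), its exterior powers `H.exteriorPower d` on Mathlib's `⋀[ℚ]^d V` (weight `d·n`;
`Motives/HodgeStructureExteriorPowerGeneralWeight`) and the tree's `SubHodgeStructure`.  «Stable under `ℂ*`» is replaced by
«stable under the Hodge group `Hg(H)(ℚ)`», which the tree already knows to characterise sub-Hodge structures of EVERY pure `H`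
(`exists_subHodgeStructure_iff_forall_hodgeGroup_self`, `Motives/HodgeGroupInvariantsRationalPoints`), and «stabilizing `U` is
the same as stabilizing the line `⋀ᵈ U`» is the tree's Chevalley–Plücker lemma (`ChevalleyLine.map_span_eq_…`,
`Motives/SubHodgeStructureHodgeGroupStable` §1; Green–Griffiths–Kerr §I.B Remark (i)).
* §1 (linear algebra) two bases of the same subspace have proportional `d`-vectors, by a non-zero scalar (Bourbaki's
  `x₁ ∧ ⋯ ∧ x_d = det · e₁ ∧ ⋯ ∧ e_d`): the LINE `ℚ · (w₁ ∧ ⋯ ∧ w_d) ⊆ ⋀ᵈ V` depends only on `W = span(w)`.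
* §2 **`exists_subHodgeStructure_span_iff_ιMulti_mem_hodgeClasses`** — for `w : Fin d → V` linearly independent and `P + P = d·n`:
  **`span(w)` underlies a sub-Hodge structure of `H` iff `w₁ ∧ ⋯ ∧ w_d ∈ Hdg^P(⋀ᵈ H)`** (`⟸`, the new direction: `Hg(H)(ℚ)` fixes
  the Hodge classes of `⋀ᵈ H` (`exteriorPower_map_eq_of_mem_hodgeGroup`), hence stabilizes `span(w)` (Remark (i)), hence `span(w)`
  is a sub-Hodge structure; `⟹` is the tree's `SubHodgeStructure.ιMulti_mem_hodgeClasses_exteriorPower`); the same for a subspace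
  `W` with `dim W = d` and any basis of it inside; odd `d·n` ⟹ no `d`-dimensional sub-Hodge structure.
* §3 **`exists_subHodgeStructure_span_iff_exists_subHodgeStructure_line`** — «`⋀ᵈ U_ℚ` being a Hodge substructure of `⋀ᵈ H_ℚ`»:
  `span(w)` underlies a sub-Hodge structure of `H` iff the determinant line `ℚ · (w₁ ∧ ⋯ ∧ w_d)` underlies a sub-Hodge structure of
  `⋀ᵈ H` (a rank-one `ℚ`-Hodge structure is of type `(P, P)`: `Motives/HodgeStructureRankOne`).
* §4 the «flat translate» form: for an automorphism `g` of `V` (a flat translate read in one fibre), `g(W)` underlies a sub-Hodge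
  structure iff `⋀ᵈ g (w₁ ∧ ⋯ ∧ w_d) ∈ Hdg^P(⋀ᵈ H)`.

NOT HERE: the variation / algebraicity half of Cor. 1.4 (it is Cor. 1.3 applied to the exterior power variation `⋀ᵈ 𝒱`, whose
`VHSData` the tree does not yet carry); the `ℂ*`-action itself (the tree's route is through `Hg(H)`, which contains `h(U¹)`).

## References

* [CattaniDeligneKaplan1995] E. Cattani, P. Deligne, A. Kaplan, *On the locus of Hodge classes*, J. Amer. Math. Soc. 8 (1995)
  483–506: Cor. 1.4 and its proof (p. 486).
* [GreenGriffithsKerr2012] M. Green, P. Griffiths, M. Kerr, *Mumford–Tate Groups and Domains*, Ann. of Math. Studies 183 (2012),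
  §I.B, proof of (I.B.1) Remark (i), (I.B.5).
* [BourbakiAlgebraI1989] N. Bourbaki, *Algebra I, Chapters 1–3*, Springer 1989, Ch. III §7 no. 9, Prop. 12 and Thm. 2.
* [VoisinHodgeI2002] C. Voisin, *Hodge Theory and Complex Algebraic Geometry I*, CUP 2002, §7.3.1 Def. 7.24, §11.1.
-/

noncomputable section

open scoped TensorProduct

namespace Literature.AlgebraicGeometry.Motives

/-! ### §1 The determinant line `ℚ · (w₁ ∧ ⋯ ∧ w_d)` depends only on `span(w)` -/

namespace ChevalleyLine

open ExteriorAlgebra Literature.LinearAlgebra.Alternating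

section CommRing

variable {R : Type*} [CommRing R] {M : Type*} [AddCommGroup M] [Module R M] {d : ℕ}

/-- **Bourbaki's `x₁ ∧ ⋯ ∧ x_d = det_e(x) · e₁ ∧ ⋯ ∧ e_d`, read in `⋀(M)` for a family `w` inside the span of a linearly
independent family `v`** (both indexed by `Fin d`): `w₁ ∧ ⋯ ∧ w_d = det_v(w) · v₁ ∧ ⋯ ∧ v_d`, the determinant taken in the
basis `v` of `span(v)`. [cite: BourbakiAlgebraI1989, Ch. III §7 no. 9 Thm. 2] -/
theorem ιMulti_eq_det_smul_of_forall_mem {v w : Fin d → M} (hv : LinearIndependent R v)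
    (hw : ∀ i, w i ∈ Submodule.span R (Set.range v)) :
    ιMulti R d w = (Module.Basis.span hv).det (fun i => ⟨w i, hw i⟩) • ιMulti R d v := by
  set U : Submodule R M := Submodule.span R (Set.range v)
  set b : Module.Basis (Fin d) R U := Module.Basis.span hv
  have hb : (U.subtype ∘ fun i => (b i : U)) = v :=
    funext fun i => congrArg Subtype.val (Module.Basis.span_apply hv i)
  have hx : (U.subtype ∘ fun i => (⟨w i, hw i⟩ : U)) = w := funext fun _ => rfl
  have key := congrArg (ExteriorAlgebra.map U.subtype) (ιMulti_eq_det_smul_ιMulti b (fun i => (⟨w i, hw i⟩ : U)))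
  rw [map_smul, ExteriorAlgebra.map_apply_ιMulti, ExteriorAlgebra.map_apply_ιMulti,
    show (U.subtype ∘ ⇑b) = v from hb, hx] at key
  exact key

/-- The same in the `d`-th exterior power `⋀[R]^d M`: `w₁ ∧ ⋯ ∧ w_d = det_v(w) · v₁ ∧ ⋯ ∧ v_d` for `w` inside `span(v)`.
[cite: BourbakiAlgebraI1989, Ch. III §7 no. 9 Thm. 2] -/
theorem exteriorPower_ιMulti_eq_det_smul_of_forall_mem {v w : Fin d → M} (hv : LinearIndependent R v)
    (hw : ∀ i, w i ∈ Submodule.span R (Set.range v)) :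
    exteriorPower.ιMulti R d w = (Module.Basis.span hv).det (fun i => ⟨w i, hw i⟩) • exteriorPower.ιMulti R d v := by
  rw [← Subtype.coe_inj, Submodule.coe_smul, exteriorPower.ιMulti_apply_coe, exteriorPower.ιMulti_apply_coe]
  exact ιMulti_eq_det_smul_of_forall_mem hv hw

end CommRing

section Field

variable {K : Type*} [Field K] {M : Type*} [AddCommGroup M] [Module K M] {d : ℕ}

/-- **Two bases of the same subspace have proportional `d`-vectors, by a NON-ZERO scalar**: if `v`, `w : Fin d → M` are both
linearly independent and `w` lies in `span(v)`, then `w₁ ∧ ⋯ ∧ w_d = c · v₁ ∧ ⋯ ∧ v_d` with `c ≠ 0` (the `d`-vector of a linearly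
independent family is non-zero, Bourbaki Prop. 12).  So the line `K · (w₁ ∧ ⋯ ∧ w_d) ⊆ ⋀ᵈ M` depends only on the subspace.
[cite: BourbakiAlgebraI1989, Ch. III §7 no. 9 Prop. 12 and Thm. 2] -/
theorem exists_exteriorPower_ιMulti_eq_smul_of_forall_mem {v w : Fin d → M} (hv : LinearIndependent K v)
    (hw : LinearIndependent K w) (hwv : ∀ i, w i ∈ Submodule.span K (Set.range v)) :
    ∃ c : K, c ≠ 0 ∧ exteriorPower.ιMulti K d w = c • exteriorPower.ιMulti K d v := by
  refine ⟨_, fun hc => ?_, exteriorPower_ιMulti_eq_det_smul_of_forall_mem hv hwv⟩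
  have h := exteriorPower_ιMulti_eq_det_smul_of_forall_mem hv hwv
  rw [hc, zero_smul] at h
  exact exteriorPower_ιMulti_ne_zero_of_linearIndependent hw h

/-- The two determinant lines coincide: `K · (w₁ ∧ ⋯ ∧ w_d) = K · (v₁ ∧ ⋯ ∧ v_d)` for two linearly independent families spanning
the same subspace. [cite: BourbakiAlgebraI1989, Ch. III §7 no. 9 Prop. 12 and Thm. 2] -/
theorem span_exteriorPower_ιMulti_eq_of_span_eq {v w : Fin d → M} (hv : LinearIndependent K v) (hw : LinearIndependent K w)
    (h : Submodule.span K (Set.range w) = Submodule.span K (Set.range v)) :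
    K ∙ exteriorPower.ιMulti K d w = K ∙ exteriorPower.ιMulti K d v := by
  obtain ⟨c, hc, hcw⟩ := exists_exteriorPower_ιMulti_eq_smul_of_forall_mem hv hw
    fun i => h.le (Submodule.subset_span ⟨i, rfl⟩)
  rw [hcw]
  exact Submodule.span_singleton_smul_eq hc.isUnit _

/-- Membership of the `d`-vector in a subspace of `⋀ᵈ M` (e.g. a space of Hodge classes) does not depend on the basis of the
subspace it is computed from. [cite: BourbakiAlgebraI1989, Ch. III §7 no. 9 Prop. 12 and Thm. 2] -/
theorem exteriorPower_ιMulti_mem_iff_of_span_eq {v w : Fin d → M} (hv : LinearIndependent K v) (hw : LinearIndependent K w)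
    (h : Submodule.span K (Set.range w) = Submodule.span K (Set.range v)) (T : Submodule K (⋀[K]^d M)) :
    exteriorPower.ιMulti K d w ∈ T ↔ exteriorPower.ιMulti K d v ∈ T := by
  obtain ⟨c, hc, hcw⟩ := exists_exteriorPower_ιMulti_eq_smul_of_forall_mem hv hw
    fun i => h.le (Submodule.subset_span ⟨i, rfl⟩)
  rw [hcw]
  exact T.smul_mem_iff hc

end Field

end ChevalleyLine

/-! ### §2 `span(w)` underlies a sub-Hodge structure iff `w₁ ∧ ⋯ ∧ w_d` is a Hodge class of `⋀ᵈ H` -/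

namespace HodgeStructure

universe u

variable {V : Type u} [AddCommGroup V] [Module ℚ V] [Module.Finite ℚ V] {n : ℤ} {H : HodgeStructure V n} {d : ℕ}

/-- A linearly independent `w : Fin d → V` inside a `d`-dimensional `W` spans `W` (private plumbing). [folklore] -/
private theorem span_eq_of_linearIndependent_of_finrank_eq {W : Submodule ℚ V} {w : Fin d → V} (hw : LinearIndependent ℚ w)
    (hwW : ∀ i, w i ∈ W) (hd : Module.finrank ℚ W = d) : Submodule.span ℚ (Set.range w) = W :=
  Submodule.eq_of_le_of_finrank_eq (Submodule.span_le.2 (Set.range_subset_iff.2 hwW))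
    (by rw [finrank_span_eq_card hw, Fintype.card_fin, hd])

/-- **Cattani–Deligne–Kaplan, proof of Cor. 1.4, the new direction: if `w₁ ∧ ⋯ ∧ w_d` is a Hodge class of `⋀ᵈ H` (of type
`(P, P)`, `2P = d·n`) for a linearly independent `w`, then `span(w)` underlies a sub-Hodge structure of `H`.**  Proof as
printed, with `ℂ*` replaced by the Hodge group on `ℚ`-points: `Hg(H)(ℚ)` fixes every Hodge class of `⋀ᵈ H`
(`exteriorPower_map_eq_of_mem_hodgeGroup`), so `⋀ᵈ g` fixes `w₁ ∧ ⋯ ∧ w_d`, so `g(span w) = span w` («stabilizing `U` is the same as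
stabilizing the line `⋀ᵈ U`», `ChevalleyLine.map_span_eq_of_exteriorPower_map_ιMulti_eq`), and an `Hg(H)(ℚ)`-stable rational
subspace underlies a sub-Hodge structure (`exists_subHodgeStructure_iff_forall_hodgeGroup_self`).
[cite: CattaniDeligneKaplan1995, proof of Cor. 1.4 (p. 486)] [cite: GreenGriffithsKerr2012, §I.B Remark (i) and (I.B.5)] -/
theorem exists_subHodgeStructure_span_of_ιMulti_mem_hodgeClasses {w : Fin d → V} (hw : LinearIndependent ℚ w) {P : ℤ}
    (hP : P + P = d * n) (hω : exteriorPower.ιMulti ℚ d w ∈ (H.exteriorPower d).hodgeClasses P) :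
    ∃ S : SubHodgeStructure H, S.toSubmodule = Submodule.span ℚ (Set.range w) := by
  haveI : HodgeTensorFacts.{u, u} := hodgeTensorFacts_holds
  refine (exists_subHodgeStructure_iff_forall_hodgeGroup_self H _).2 fun g hg v hv => ?_
  have hfix := exteriorPower_map_eq_of_mem_hodgeGroup H hP hω hg
  exact (ChevalleyLine.map_span_eq_of_exteriorPower_map_ιMulti_eq hw g hfix).le ⟨v, hv, rfl⟩

/-- The same for a given subspace `W` of dimension `d` and a linearly independent `w : Fin d → V` inside `W` (a basis of `W`
read in `V`): `w₁ ∧ ⋯ ∧ w_d ∈ Hdg^P(⋀ᵈ H)`, `2P = d·n` ⟹ `W` underlies a sub-Hodge structure.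
[cite: CattaniDeligneKaplan1995, proof of Cor. 1.4 (p. 486)] [cite: GreenGriffithsKerr2012, §I.B Remark (i) and (I.B.5)] -/
theorem exists_subHodgeStructure_of_ιMulti_mem_hodgeClasses {W : Submodule ℚ V} {w : Fin d → V} (hw : LinearIndependent ℚ w)
    (hwW : ∀ i, w i ∈ W) (hd : Module.finrank ℚ W = d) {P : ℤ} (hP : P + P = d * n)
    (hω : exteriorPower.ιMulti ℚ d w ∈ (H.exteriorPower d).hodgeClasses P) :
    ∃ S : SubHodgeStructure H, S.toSubmodule = W := by
  rw [← span_eq_of_linearIndependent_of_finrank_eq hw hwW hd]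
  exact exists_subHodgeStructure_span_of_ιMulti_mem_hodgeClasses hw hP hω

/-- The Hodge type of the determinant of a sub-Hodge structure is forced by the weight: if `S` has dimension `d` and
`P + P = d·n` then `detType(S) = P` (the tree's `SubHodgeStructure.detType_add_detType`). [cite: GreenGriffithsKerr2012, §I.B proof of (I.B.1), Step one] -/
theorem SubHodgeStructure.detType_eq_of_add_self_eq (S : SubHodgeStructure H) (hd : Module.finrank ℚ S.toSubmodule = d) {P : ℤ}
    (hP : P + P = d * n) : S.toHodgeStructure.detType = P := by
  have h := S.detType_add_detType hd
  omega

/-- **The printed direction: if `W` underlies a sub-Hodge structure then the `d`-vector of any basis of `W` is a Hodge class of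
`⋀ᵈ H` of type `(P, P)`, `2P = d·n`** («`⋀ⁿ U_ℚ` is a Hodge substructure of `⋀ⁿ H_ℚ`»; the tree's
`SubHodgeStructure.ιMulti_mem_hodgeClasses_exteriorPower` with the type pinned by the weight).
[cite: CattaniDeligneKaplan1995, proof of Cor. 1.4 (p. 486)] [cite: GreenGriffithsKerr2012, §I.B proof of (I.B.1), Step one and Remark (i)] -/
theorem ιMulti_mem_hodgeClasses_of_exists_subHodgeStructure {W : Submodule ℚ V} (hS : ∃ S : SubHodgeStructure H, S.toSubmodule = W)
    {w : Fin d → V} (hwW : ∀ i, w i ∈ W) (hd : Module.finrank ℚ W = d) {P : ℤ} (hP : P + P = d * n) :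
    exteriorPower.ιMulti ℚ d w ∈ (H.exteriorPower d).hodgeClasses P := by
  obtain ⟨S, rfl⟩ := hS
  rw [← S.detType_eq_of_add_self_eq hd hP]
  exact S.ιMulti_mem_hodgeClasses_exteriorPower hd hwW

/-- **CDK95, proof of Cor. 1.4 — the criterion.**  For `H : HodgeStructure V n`, `w : Fin d → V` linearly independent and
`P + P = d·n`: **`span(w₁, …, w_d)` underlies a sub-Hodge structure of `H` if and only if `w₁ ∧ ⋯ ∧ w_d` is a Hodge class of
`⋀ᵈ H` of type `(P, P)`** («`U_ℚ ⊂ H_ℚ` is a sub-Hodge structure … if and only if … `⋀ⁿ U_ℚ` [is] a Hodge substructure of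
`⋀ⁿ H_ℚ`, and reduces us to the one-dimensional case»). [cite: CattaniDeligneKaplan1995, proof of Cor. 1.4 (p. 486)]
[cite: GreenGriffithsKerr2012, §I.B Remark (i) and (I.B.5)] -/
theorem exists_subHodgeStructure_span_iff_ιMulti_mem_hodgeClasses {w : Fin d → V} (hw : LinearIndependent ℚ w) {P : ℤ}
    (hP : P + P = d * n) :
    (∃ S : SubHodgeStructure H, S.toSubmodule = Submodule.span ℚ (Set.range w)) ↔
      exteriorPower.ιMulti ℚ d w ∈ (H.exteriorPower d).hodgeClasses P :=
  ⟨fun hS => ιMulti_mem_hodgeClasses_of_exists_subHodgeStructure hS (fun i => Submodule.subset_span ⟨i, rfl⟩)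
      (by rw [finrank_span_eq_card hw, Fintype.card_fin]) hP,
    exists_subHodgeStructure_span_of_ιMulti_mem_hodgeClasses hw hP⟩

/-- The criterion for a given subspace `W` (`dim W = d`) and any linearly independent `w : Fin d → V` inside `W`:
**`W` underlies a sub-Hodge structure iff `w₁ ∧ ⋯ ∧ w_d ∈ Hdg^P(⋀ᵈ H)`** (`2P = d·n`).
[cite: CattaniDeligneKaplan1995, proof of Cor. 1.4 (p. 486)] [cite: GreenGriffithsKerr2012, §I.B Remark (i) and (I.B.5)] -/
theorem exists_subHodgeStructure_iff_ιMulti_mem_hodgeClasses {W : Submodule ℚ V} {w : Fin d → V} (hw : LinearIndependent ℚ w)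
    (hwW : ∀ i, w i ∈ W) (hd : Module.finrank ℚ W = d) {P : ℤ} (hP : P + P = d * n) :
    (∃ S : SubHodgeStructure H, S.toSubmodule = W) ↔ exteriorPower.ιMulti ℚ d w ∈ (H.exteriorPower d).hodgeClasses P := by
  rw [← span_eq_of_linearIndependent_of_finrank_eq hw hwW hd]
  exact exists_subHodgeStructure_span_iff_ιMulti_mem_hodgeClasses hw hP

/-- **No sub-Hodge structures of dimension `d` when `d·n` is odd** («Then `𝒱` is of even weight `2p`», the dimension-one case
of the printed proof; in general the weight `d·n` of the determinant line `⋀ᵈ U` of a sub-Hodge structure `U` is even).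
[cite: CattaniDeligneKaplan1995, proof of Cor. 1.4 (p. 486)] [cite: GreenGriffithsKerr2012, §I.B proof of (I.B.1), Step one] -/
theorem not_exists_subHodgeStructure_of_odd {W : Submodule ℚ V} (hd : Module.finrank ℚ W = d) (hodd : Odd ((d : ℤ) * n)) :
    ¬ ∃ S : SubHodgeStructure H, S.toSubmodule = W := by
  rintro ⟨S, rfl⟩
  have h := S.detType_add_detType hd
  obtain ⟨k, hk⟩ := hodd
  omega

/-- In particular a LINE `ℚ · v` (`v ≠ 0`) underlies a sub-Hodge structure of `H` iff the weight is even, `n = 2P`, and `v` is a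
Hodge class of type `(P, P)` — the case `d = 1` («`U_ℚ` is a Hodge substructure if and only if `e` is of type `(0,0)`», after
the Tate twist to weight `0`).  Stated for `P + P = n`. [cite: CattaniDeligneKaplan1995, proof of Cor. 1.4 (p. 486)]
[cite: VoisinHodgeI2002, §7.3.1 Def. 7.24 and §11.1] -/
theorem exists_subHodgeStructure_span_singleton_iff_mem_hodgeClasses {v : V} (hv : v ≠ 0) {P : ℤ} (hP : P + P = n) :
    (∃ S : SubHodgeStructure H, S.toSubmodule = ℚ ∙ v) ↔ v ∈ H.hodgeClasses P := by
  haveI : HodgeTensorFacts.{u, u} := hodgeTensorFacts_holds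
  constructor
  · rintro ⟨S, hS⟩
    have h1 : Module.finrank ℚ S.toSubmodule = 1 := by rw [hS, finrank_span_singleton hv]
    have hvS : v ∈ S.toSubmodule := hS ▸ Submodule.mem_span_singleton_self v
    have h := (S.mem_hodgeClasses_iff P ⟨v, hvS⟩).1 (by
      rw [S.toHodgeStructure.hodgeClasses_eq_top_of_finrank_eq_one (k := P) (by omega) h1]
      exact Submodule.mem_top)
    exact h
  · intro hvP
    refine (exists_subHodgeStructure_iff_forall_hodgeGroup_self H _).2 fun g hg x hx => ?_
    obtain ⟨c, rfl⟩ := Submodule.mem_span_singleton.1 hx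
    rw [map_smul, apply_eq_self_of_mem_hodgeGroup H hg hP hvP]
    exact Submodule.smul_mem _ c (Submodule.mem_span_singleton_self v)

/-! ### §3 … iff the determinant line `ℚ · (w₁ ∧ ⋯ ∧ w_d)` underlies a sub-Hodge structure of `⋀ᵈ H` -/

/-- **«This amounts to `⋀ⁿ U_ℚ` being a Hodge substructure of `⋀ⁿ H_ℚ`»**: for `w : Fin d → V` linearly independent,
`span(w)` underlies a sub-Hodge structure of `H` **iff** the determinant line `ℚ · (w₁ ∧ ⋯ ∧ w_d) ⊆ ⋀ᵈ V` underlies a sub-Hodge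
structure of `⋀ᵈ H`.  (`⟸`: a rank-one `ℚ`-Hodge structure of weight `d·n` has `d·n = 2P` even and consists of Hodge classes of type
`(P, P)` — `Motives/HodgeStructureRankOne` —, so `w₁ ∧ ⋯ ∧ w_d ∈ Hdg^P(⋀ᵈ H)` and §2 applies; `⟹`: a line spanned by a Hodge class
is a sub-Hodge structure.) [cite: CattaniDeligneKaplan1995, proof of Cor. 1.4 (p. 486)] [cite: GreenGriffithsKerr2012, §I.B Remark (i)] -/
theorem exists_subHodgeStructure_span_iff_exists_subHodgeStructure_line {w : Fin d → V} (hw : LinearIndependent ℚ w) :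
    (∃ S : SubHodgeStructure H, S.toSubmodule = Submodule.span ℚ (Set.range w)) ↔
      ∃ L : SubHodgeStructure (H.exteriorPower d), L.toSubmodule = ℚ ∙ exteriorPower.ιMulti ℚ d w := by
  have hω : exteriorPower.ιMulti ℚ d w ≠ 0 :=
    Literature.LinearAlgebra.Alternating.exteriorPower_ιMulti_ne_zero_of_linearIndependent hw
  constructor
  · rintro ⟨S, hS⟩
    have hd : Module.finrank ℚ S.toSubmodule = d := by rw [hS, finrank_span_eq_card hw, Fintype.card_fin]
    have hP := S.detType_add_detType hd
    have hwS : ∀ i, w i ∈ S.toSubmodule := fun i => by rw [hS]; exact Submodule.subset_span ⟨i, rfl⟩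
    exact (exists_subHodgeStructure_span_singleton_iff_mem_hodgeClasses hω hP).2
      (S.ιMulti_mem_hodgeClasses_exteriorPower hd hwS)
  · rintro ⟨L, hL⟩
    have h1 : Module.finrank ℚ L.toSubmodule = 1 := by rw [hL, finrank_span_singleton hω]
    obtain ⟨P, hP⟩ := L.toHodgeStructure.even_of_finrank_eq_one h1
    have hmem := (exists_subHodgeStructure_span_singleton_iff_mem_hodgeClasses (H := H.exteriorPower d) hω
      (P := P) hP.symm).1 ⟨L, hL⟩
    exact exists_subHodgeStructure_span_of_ιMulti_mem_hodgeClasses hw hP.symm hmem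

/-- The determinant-line form for a given subspace `W` (`dim W = d`) and a linearly independent `w : Fin d → V` inside it:
`W` underlies a sub-Hodge structure of `H` iff `ℚ · (w₁ ∧ ⋯ ∧ w_d)` underlies a sub-Hodge structure of `⋀ᵈ H`; by §1 the line does
not depend on the choice of `w`. [cite: CattaniDeligneKaplan1995, proof of Cor. 1.4 (p. 486)] [cite: GreenGriffithsKerr2012, §I.B Remark (i)] -/
theorem exists_subHodgeStructure_iff_exists_subHodgeStructure_line {W : Submodule ℚ V} {w : Fin d → V}
    (hw : LinearIndependent ℚ w) (hwW : ∀ i, w i ∈ W) (hd : Module.finrank ℚ W = d) :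
    (∃ S : SubHodgeStructure H, S.toSubmodule = W) ↔
      ∃ L : SubHodgeStructure (H.exteriorPower d), L.toSubmodule = ℚ ∙ exteriorPower.ιMulti ℚ d w := by
  rw [← span_eq_of_linearIndependent_of_finrank_eq hw hwW hd]
  exact exists_subHodgeStructure_span_iff_exists_subHodgeStructure_line hw

/-! ### §4 Flat translates read in one fibre: `g(W)` is a sub-Hodge structure iff `⋀ᵈ g (w₁ ∧ ⋯ ∧ w_d)` is a Hodge class -/

omit [Module.Finite ℚ V] in
/-- `⋀ᵈ g (w₁ ∧ ⋯ ∧ w_d) = g w₁ ∧ ⋯ ∧ g w_d` and `g(span w) = span(g ∘ w)` (private plumbing). [folklore] -/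
private theorem map_span_range_eq (g : V →ₗ[ℚ] V) (w : Fin d → V) :
    (Submodule.span ℚ (Set.range w)).map g = Submodule.span ℚ (Set.range (g ∘ w)) := by
  rw [Submodule.map_span, ← Set.range_comp]

/-- **Cor. 1.4 for a translate inside one Hodge structure**: for an automorphism `g` of `V` (in the variation: the flat transport
of `U_ℚ ⊆ 𝒱_s` to the fibre `𝒱_t`, read after identifying the local system), a linearly independent `w : Fin d → V` and
`P + P = d·n`: **`g(span w)` underlies a sub-Hodge structure of `H` iff `⋀ᵈ g (w₁ ∧ ⋯ ∧ w_d) ∈ Hdg^P(⋀ᵈ H)`** — «the locus where some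
flat translate of `U_ℚ` is a Hodge substructure» is the locus where the translate of the single vector `w₁ ∧ ⋯ ∧ w_d` of `⋀ᵈ 𝒱_s` is
of type `(P, P)` («reduces us to the one-dimensional case»). [cite: CattaniDeligneKaplan1995, Cor. 1.4 and its proof (p. 486)] -/
theorem exists_subHodgeStructure_map_span_iff_exteriorPower_map_ιMulti_mem (g : V ≃ₗ[ℚ] V) {w : Fin d → V}
    (hw : LinearIndependent ℚ w) {P : ℤ} (hP : P + P = d * n) :
    (∃ S : SubHodgeStructure H, S.toSubmodule = (Submodule.span ℚ (Set.range w)).map (g : V →ₗ[ℚ] V)) ↔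
      exteriorPower.map d (g : V →ₗ[ℚ] V) (exteriorPower.ιMulti ℚ d w) ∈ (H.exteriorPower d).hodgeClasses P := by
  rw [map_span_range_eq, exteriorPower.map_apply_ιMulti]
  exact exists_subHodgeStructure_span_iff_ιMulti_mem_hodgeClasses (hw.map' (g : V →ₗ[ℚ] V) g.ker) hP

omit [Module.Finite ℚ V] in
/-- The same for any INJECTIVE linear map `g : V →ₗ[ℚ] V'` into the carrier of another Hodge structure `H'` of weight `n` (the
flat transport `𝒱_s → 𝒱_t` between two fibres): `g(span w)` underlies a sub-Hodge structure of `H'` iff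
`g w₁ ∧ ⋯ ∧ g w_d = ⋀ᵈ g (w₁ ∧ ⋯ ∧ w_d) ∈ Hdg^P(⋀ᵈ H')`. [cite: CattaniDeligneKaplan1995, Cor. 1.4 and its proof (p. 486)] -/
theorem exists_subHodgeStructure_map_span_iff_of_injective {V' : Type u} [AddCommGroup V'] [Module ℚ V'] [Module.Finite ℚ V']
    {H' : HodgeStructure V' n} (g : V →ₗ[ℚ] V') (hg : Function.Injective g) {w : Fin d → V} (hw : LinearIndependent ℚ w)
    {P : ℤ} (hP : P + P = d * n) :
    (∃ S : SubHodgeStructure H', S.toSubmodule = (Submodule.span ℚ (Set.range w)).map g) ↔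
      exteriorPower.map d g (exteriorPower.ιMulti ℚ d w) ∈ (H'.exteriorPower d).hodgeClasses P := by
  rw [Submodule.map_span, ← Set.range_comp, exteriorPower.map_apply_ιMulti]
  exact exists_subHodgeStructure_span_iff_ιMulti_mem_hodgeClasses (hw.map' g (LinearMap.ker_eq_bot.2 hg)) hP

end HodgeStructure

end Literature.AlgebraicGeometry.Motives

end
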